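import Mathlib.GroupTheory.PresentedGroup
import Mathlib.SetTheory.Cardinal.Finite
import Mathlib.Tactic

/-!
# Coset-enumeration certificates: the generic layer

A kernel-checkable format for the output of a (proof-logging) Todd–Coxeter coset enumeration of a
group `G` over a cyclic subgroup `⟨c⟩`.  Cosets are represented by *left-multiplication operators*
`S : G → G` (`S w = s₁ (s₂ (⋯ (sₙ w)))` for the coset representative word `s₁ ⋯ sₙ`), the
`⟨c⟩`-coordinate is an integer exponent carried by `zl c j t = c ^ j * t`, a table entry is the
proposition `F c S x k T` ("`S·x = cᵏ·T`") and a coincidence is `C c A j B` ("`A = cʲ·B`").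
The combinators `df dv iv co cv ct xf rd hr hrc` are the inference rules of coset enumeration
(definition, deduction bookkeeping, coincidence, transfer, `⟨c⟩`-relation); a certificate file is a
list of such one-line inferences plus `rw`-chains for the relator scans, ending in
`card_le_of_cosetTable` (a finite right-`gens`-stable family containing `1` exhausts `G`).
Solo programme `solo-SmoothPoincare4-informed`, session s110.
-/

namespace Summit.SmoothPoincare4.SmoothPoincare4.Theorems
namespace CosetEnum

variable {G : Type*} [Group G]

/-- `zl c j t = cʲ t`. -/
def zl (c : G) (j : ℤ) (t : G) : G := c ^ j * t

/-- Table entry `S·x = cᵏ·T` (as operators: `cⁱ S(x w) = cⁱ⁺ᵏ T(w)` for all `i, w`). -/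
abbrev F (c : G) (S : G → G) (x : G) (k : ℤ) (T : G → G) : Prop :=
  ∀ (i : ℤ) (w : G), zl c i (S (x * w)) = zl c (i + k) (T w)

/-- Coincidence `A = cʲ·B`. -/
abbrev C (c : G) (A : G → G) (j : ℤ) (B : G → G) : Prop :=
  ∀ (i : ℤ) (w : G), zl c i (A w) = zl c (i + j) (B w)

/-- Change the `⟨c⟩`-exponent along an integer identity. -/
theorem zl_eq {c : G} {j k : ℤ} (t : G) (h : j = k) : zl c j t = zl c k t := by rw [h]

/-- `zl c 0 t = t`. -/
theorem zl_zero (c t : G) : zl c 0 t = t := by simp [zl]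

/-- The subgroup generator edge at the base coset: `1·c = c·1`. -/
theorem zc (c : G) (i : ℤ) (w : G) : zl c i (c * w) = zl c (i + 1) w := by
  simp only [zl, zpow_add, zpow_one, mul_assoc]

/-- The inverse subgroup generator edge at the base coset: `1·c⁻¹ = c⁻¹·1`. -/
theorem zC (c : G) (i : ℤ) (w : G) : zl c i (c⁻¹ * w) = zl c (i + -1) w := by
  simp only [zl, zpow_add, zpow_neg, zpow_one, mul_assoc]

/-- `a (a⁻¹ b) = b` (walking a definition edge backwards). -/
theorem mc (a b : G) : a * (a⁻¹ * b) = b := mul_inv_cancel_left a b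

/-- `a⁻¹ (a b) = b` (walking a definition edge backwards, inverse generator). -/
theorem mC (a b : G) : a⁻¹ * (a * b) = b := inv_mul_cancel_left a b

/-- Definition edge `T := S·x`. -/
theorem df {c : G} (S : G → G) (x : G) (T : G → G) (h : ∀ w, T w = S (x * w)) : F c S x 0 T := by
  intro i w; rw [h, add_zero]

/-- Definition edge read backwards: `T·x⁻¹ = S`. -/
theorem dv {c : G} (S : G → G) (x : G) (T : G → G) (h : ∀ w, T w = S (x * w)) : F c T x⁻¹ 0 S := by
  intro i w; rw [h, mul_inv_cancel_left, add_zero]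


/-- Definition edge read backwards, inverse generator: `T := S·g⁻¹` gives `T·g = S`. -/
theorem dvi {c : G} (S : G → G) (g : G) (T : G → G) (h : ∀ w, T w = S (g⁻¹ * w)) : F c T g 0 S := by
  intro i w; rw [h, inv_mul_cancel_left, add_zero]

/-- Inverse entry for an inverse generator: `S·g⁻¹ = cᵏ·T ⟹ T·g = c⁻ᵏ·S`. -/
theorem ivi {c : G} {S T : G → G} {g : G} {k : ℤ} (h : F c S g⁻¹ k T) : F c T g (-k) S := by
  intro i w
  have e := h (i + -k) (g * w)
  rw [inv_mul_cancel_left] at e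
  rw [e]
  exact zl_eq _ (by omega)

/-- `⟨c⟩`-relation exponent bookkeeping. -/
theorem fH {c : G} {a b : ℤ} (h : c ^ a = 1) (e : a = b) : c ^ b = 1 := e ▸ h

/-- Rotating a relator: `a * b = 1 ⟹ b * a = 1`. -/
theorem rot {a b : G} (h : a * b = 1) : b * a = 1 :=
  (congrArg (· * a) (inv_eq_of_mul_eq_one_right h)).symm.trans (inv_mul_cancel a)

/-- Face of a relator cell: from `a * b = 1`, `a⁻¹ * u = b * u`. -/
theorem face_of {a b : G} (h : a * b = 1) (u : G) : a⁻¹ * u = b * u :=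
  congrArg (· * u) (inv_eq_of_mul_eq_one_right h)

/-- Face of a relator cell starting with an inverse generator: from `g⁻¹ * b = 1`, `g * u = b * u`. -/
theorem face_ofi {g b : G} (h : g⁻¹ * b = 1) (u : G) : g * u = b * u :=
  congrArg (· * u) ((inv_inv g).symm.trans (inv_eq_of_mul_eq_one_right h))

/-- Inverse entry: `S·x = cᵏ·T ⟹ T·x⁻¹ = c⁻ᵏ·S`. -/
theorem iv {c : G} {S T : G → G} {x : G} {k : ℤ} (h : F c S x k T) : F c T x⁻¹ (-k) S := by
  intro i w
  have e := h (i + -k) (x⁻¹ * w)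
  rw [mul_inv_cancel_left] at e
  rw [e]
  exact zl_eq _ (by omega)

/-- Coincidence from two entries in the same place: `S·x = cᵏ¹·T₁` and `S·x = cᵏ²·T₂ ⟹ T₂ = cᵏ¹⁻ᵏ²·T₁`. -/
theorem co {c : G} {S T₁ T₂ : G → G} {x : G} {k₁ k₂ : ℤ} (h₁ : F c S x k₁ T₁) (h₂ : F c S x k₂ T₂) :
    C c T₂ (k₁ - k₂) T₁ := by
  intro i w
  have e₁ := h₁ (i - k₂) w
  have e₂ := h₂ (i - k₂) w
  rw [zl_eq (T₂ w) (show i - k₂ + k₂ = i by omega)] at e₂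
  rw [← e₂, e₁]
  exact zl_eq _ (by omega)

/-- Coincidences are symmetric: `A = cʲ·B ⟹ B = c⁻ʲ·A`. -/
theorem cv {c : G} {A B : G → G} {j : ℤ} (h : C c A j B) : C c B (-j) A := by
  intro i w
  have e := h (i + -j) w
  rw [zl_eq (B w) (show i + -j + j = i by omega)] at e
  exact e.symm

/-- Coincidences compose (union–find path compression). -/
theorem ct {c : G} {A B D : G → G} {j₁ j₂ : ℤ} (h₁ : C c A j₁ B) (h₂ : C c B j₂ D) : C c A (j₁ + j₂) D := by
  intro i w; rw [h₁, h₂]; exact zl_eq _ (by omega)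

/-- Transfer an entry along a coincidence of its source: `A = cʲ·B`, `A·x = cᵐ·U ⟹ B·x = cᵐ⁻ʲ·U`. -/
theorem xf {c : G} {A B U : G → G} {x : G} {j m : ℤ} (hc : C c A j B) (h : F c A x m U) :
    F c B x (m - j) U := by
  intro i w
  have e := hc (i - j) (x * w)
  rw [zl_eq (B (x * w)) (show i - j + j = i by omega)] at e
  rw [← e, h]
  exact zl_eq _ (by omega)

/-- Redirect an entry along a coincidence of its target. -/
theorem rd {c : G} {S T E : G → G} {x : G} {k j : ℤ} (h : F c S x k T) (hc : C c T j E) :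
    F c S x (k + j) E := by
  intro i w; rw [h, hc]; exact zl_eq _ (by omega)

/-- A relation in `⟨c⟩` from two entries in the same place with the same target. -/
theorem hr {c : G} {S T : G → G} {x : G} {k₁ k₂ : ℤ} (h₁ : F c S x k₁ T) (h₂ : F c S x k₂ T) :
    c ^ (k₂ - k₁) = 1 := by
  have e₁ := h₁ 0 1
  have e₂ := h₂ 0 1
  rw [e₁] at e₂
  simp only [zl, zero_add] at e₂
  have e := mul_right_cancel e₂
  rw [zpow_sub, ← e, mul_inv_cancel]

/-- A relation in `⟨c⟩` from a self-coincidence. -/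
theorem hrc {c : G} {A : G → G} {j : ℤ} (h : C c A j A) : c ^ j = 1 := by
  have e := h 0 1
  simp only [zl, zero_add, zpow_zero] at e
  have e' : (1 : G) * A 1 = c ^ j * A 1 := by simpa using e
  exact (mul_right_cancel e').symm

/-- Exponent bookkeeping for table entries. -/
theorem fF {c : G} {S T : G → G} {x : G} {k k' : ℤ} (h : F c S x k T) (e : k = k') : F c S x k' T := e ▸ h

/-- Exponent bookkeeping for coincidences. -/
theorem fC {c : G} {A B : G → G} {j j' : ℤ} (h : C c A j B) (e : j = j') : C c A j' B := e ▸ h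

/-- `⟨c⟩`-relations combine: `cᵃ = 1`, `cᵇ = 1 ⟹ c^(u a + v b) = 1`. -/
theorem zpow_comb_eq_one {c : G} {a b : ℤ} (u v : ℤ) (ha : c ^ a = 1) (hb : c ^ b = 1) :
    c ^ (u * a + v * b) = 1 := by
  rw [zpow_add, mul_comm u, mul_comm v, zpow_mul, zpow_mul, ha, hb, one_zpow, one_zpow, one_mul]

/-- From an entry at exponent `0`: `S (x * 1) = c ^ k * T 1`. -/
theorem F.apply_one {c : G} {S T : G → G} {x : G} {k : ℤ} (h : F c S x k T) : S (x * 1) = c ^ k * T 1 := by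
  have e := h 0 1
  simpa only [zl, zpow_zero, one_mul, zero_add] using e

/-- A finite family stable under right multiplication by a set of generators is stable under the whole
group. -/
theorem stable_of_gens {T : Set G} (hT : T.Finite) (gens : Set G) (hg : Subgroup.closure gens = ⊤)
    (step : ∀ g ∈ gens, ∀ t ∈ T, t * g ∈ T) : ∀ g : G, ∀ t ∈ T, t * g ∈ T := by
  classical
  -- stability under `x` implies stability under `x⁻¹` (finite set, injective self-map)
  have back : ∀ x : G, (∀ t ∈ T, t * x ∈ T) → ∀ t ∈ T, t * x⁻¹ ∈ T := by
    intro x hx t ht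
    haveI : Finite T := hT.to_subtype
    let φ : T → T := fun s => ⟨s.1 * x, hx s.1 s.2⟩
    have hinj : Function.Injective φ := by
      intro a b hab
      apply Subtype.ext
      have := congrArg Subtype.val hab
      exact mul_right_cancel this
    obtain ⟨s, hs⟩ := Finite.surjective_of_injective hinj ⟨t, ht⟩
    have hs' : s.1 * x = t := congrArg Subtype.val hs
    have : t * x⁻¹ = s.1 := by rw [← hs', mul_inv_cancel_right]
    rw [this]; exact s.2
  intro g
  have hg' : g ∈ Subgroup.closure gens := by rw [hg]; exact Subgroup.mem_top g
  induction hg' using Subgroup.closure_induction with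
  | mem x hx => exact step x hx
  | one => intro t ht; simpa using ht
  | mul x y _ _ ihx ihy => intro t ht; rw [← mul_assoc]; exact ihy _ (ihx t ht)
  | inv x _ ih => exact back x ih

/-- **A complete coset table over `⟨c⟩` exhausts the group.**  If `c ^ n = 1`, `rep : ι → G` hits `1`, and
every `rep i * g` (`g` a generator) is some `c ^ k * rep j`, then every element is `c ^ k * rep j` with
`0 ≤ k < n`. -/
theorem surjective_of_cosetTable {ι : Type*} [Fintype ι] (c : G) (n : ℕ) (hn0 : 0 < n)
    (hn : c ^ (n : ℤ) = 1) (rep : ι → G) (gens : Set G) (hg : Subgroup.closure gens = ⊤) (i₀ : ι)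
    (h1 : rep i₀ = 1) (hc : ∀ g ∈ gens, ∀ i, ∃ j, ∃ k : ℤ, rep i * g = c ^ k * rep j) :
    Function.Surjective (fun p : Fin n × ι => c ^ ((p.1 : ℕ) : ℤ) * rep p.2) := by
  classical
  set f : Fin n × ι → G := fun p => c ^ ((p.1 : ℕ) : ℤ) * rep p.2 with hf
  have step : ∀ g ∈ gens, ∀ t ∈ Set.range f, t * g ∈ Set.range f := by
    rintro g hgm _ ⟨⟨k, i⟩, rfl⟩
    obtain ⟨j, m, hm⟩ := hc g hgm i
    have hn0' : (0 : ℤ) < n := by exact_mod_cast hn0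
    have h0 := Int.emod_nonneg (((k : ℕ) : ℤ) + m) hn0'.ne'
    have h1 := Int.emod_lt_of_pos (((k : ℕ) : ℤ) + m) hn0'
    refine ⟨⟨⟨((((k : ℕ) : ℤ) + m) % n).toNat, by omega⟩, j⟩, ?_⟩
    show c ^ ((((((k : ℕ) : ℤ) + m) % n).toNat : ℕ) : ℤ) * rep j = c ^ ((k : ℕ) : ℤ) * rep i * g
    rw [mul_assoc, hm, ← mul_assoc, ← zpow_add, zpow_eq_zpow_emod (((k : ℕ) : ℤ) + m) hn,
      Int.toNat_of_nonneg h0]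
  have all := stable_of_gens (Set.finite_range f) gens hg step
  have h1T : (1 : G) ∈ Set.range f := ⟨(⟨0, hn0⟩, i₀), by simp [hf, h1]⟩
  intro g
  obtain ⟨p, hp⟩ := all g 1 h1T
  exact ⟨p, by simpa using hp⟩

/-- Hence the group is finite … -/
theorem finite_of_cosetTable {ι : Type*} [Fintype ι] (c : G) (n : ℕ) (hn0 : 0 < n)
    (hn : c ^ (n : ℤ) = 1) (rep : ι → G) (gens : Set G) (hg : Subgroup.closure gens = ⊤) (i₀ : ι)
    (h1 : rep i₀ = 1) (hc : ∀ g ∈ gens, ∀ i, ∃ j, ∃ k : ℤ, rep i * g = c ^ k * rep j) : Finite G :=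
  Finite.of_surjective _ (surjective_of_cosetTable c n hn0 hn rep gens hg i₀ h1 hc)

/-- … of order at most `n · |ι|`. -/
theorem card_le_of_cosetTable {ι : Type*} [Fintype ι] (c : G) (n : ℕ) (hn0 : 0 < n)
    (hn : c ^ (n : ℤ) = 1) (rep : ι → G) (gens : Set G) (hg : Subgroup.closure gens = ⊤) (i₀ : ι)
    (h1 : rep i₀ = 1) (hc : ∀ g ∈ gens, ∀ i, ∃ j, ∃ k : ℤ, rep i * g = c ^ k * rep j) :
    Nat.card G ≤ n * Fintype.card ι := by
  have h := Nat.card_le_card_of_surjective _ (surjective_of_cosetTable c n hn0 hn rep gens hg i₀ h1 hc)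
  simpa using h

end CosetEnum
end Summit.SmoothPoincare4.SmoothPoincare4.Theorems
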